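import Literature.NumberTheory.Automorphic.UnitaryGroupBorelLatticeCellCountSiegel
import Literature.NumberTheory.Automorphic.UnitaryGroupCuspIntegralSiegelMajorant
import HarnessLib

/-!
# On a Siegel set `S = Ω · S_T · (B ∩ K_U)` of `B(𝔸_F)` the unipotent part and the root values stay in
# compacta (structure clause (i) of the Borel Siegel set of `U(3)`)
(Rogawski, *Automorphic Representations of Unitary Groups in Three Variables* (1990), §2.2, p. 13;
Arthur, *A trace formula for reductive groups I*, Duke Math. J. 45 (1978), §5: on a Siegel set
`𝔖 = ω A_t K` the sets `a⁻¹ ω a` stay in a fixed compact set)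

Topic `NumberTheory/Automorphic`; namespace `Literature.NumberTheory.Automorphic.UnitaryGroup`. THEOREMS
ONLY over accepted tree modules: no definition, no named fact, no `sorry`, no instance, no notation.
Setting: the quasi-split `U(J₃)` of `E/F` (`quasiSplit F E c 3`), its Borel group `B(𝔸_F) = borelAdelic`
with torus part `torusPart b` and diagonal entries `diagUnit b.2 i` (★ `UnitaryGroupBorelSemidirect`),
and `B ∩ K_U = {k ∈ B(𝔸_F) : adelicVal k ∈ K_∞ · GL₃(𝒪̂_E)}` (★ `standardMaximalCompactGL`). The Borel
Siegel set of the cell road (brick H9b) is the pointwise product `S = Ω · S_T · (B ∩ K_U)` in the group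
`B(𝔸_F)` — `Ω ⊆ N(𝔸_F)` compact, `S_T ⊆ T(𝔸_F)` a torus Siegel set (brick H9a) whose ROOT VALUES
`d₀⁻¹ d₁`, `d₀⁻¹ d₂` lie in compact windows `R₁, R₂ ⊆ 𝔸_E` above height `1`. This file proves,
HYPOTHESES-FIRST in those letters (no Siegel-set module is imported), the structure clause the
estimates consume (★ `exists_forall_card_mul_measure_le_mul_torusRootModulus`, brick H4-d; the
oscillation brick H5b; ★ `exists_forall_enorm_kernel_sub_kernelBorel_le_of_oscillation`, brick H8c):

* §1 `continuous_rootValue₁`, `continuous_rootValue₂` — `b ↦ d₀⁻¹ d₁`, `b ↦ d₀⁻¹ d₂` are continuous on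
  `B(𝔸_F)`; `coe_diagUnit_mul_of_torusPart_eq` — diagonal entries of a product of TORUS elements
  multiply; `rootValue₁_mul`, `rootValue₂_mul`.
* §2 `torusPart_mul_mul_eq`, `borelHeight_mul_mul_eq` — for `b = n t k` (`n ∈ N(𝔸_F)`, `torusPart t = t`,
  `k ∈ B ∩ K_U`): `torusPart b = t · torusPart k` and `H(b) = H(t)` (★ `borelHeight_unipotent_mul`,
  ★ `borelHeight_mul_of_mem_comap_standardMaximalCompactGL`).
* §3 **`exists_isCompact_structure_of_mem_siegel`** — THE CLAUSE: there are compact `Ω' ⊆ G(𝔸_F)`,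
  `R₁', R₂' ⊆ 𝔸_E` such that every `b ∈ Ω · S_T · (B ∩ K_U)` with `1 ≤ H(b)` has unipotent part
  `(torusPart b)⁻¹ b ∈ Ω'` and root values in `R₁', R₂'` — the three membership hypotheses of ★ H4-d ∕
  ★ H8c VERBATIM. Proof: `b = n t k`, `k = t_k n_k` (`t_k = torusPart k`, `n_k ∈ N(𝔸_F)`, both in the
  image of the compact `B ∩ K_U`), `torusPart b = t t_k`, the root values multiply and those of `t_k`
  range in a compact (§1), and `(torusPart b)⁻¹ b = Ad((t t_k)⁻¹)(n) · n_k` lies in `W' · N_K` with `W'`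
  the compact of ★ `exists_isCompact_torusConj_mem` (torus contraction in the Heisenberg chart).

## References

* J. D. Rogawski, *Automorphic Representations of Unitary Groups in Three Variables*, Annals of
  Mathematics Studies 123 (1990), §2.2 (p. 13) [Rogawski1990].
* J. Arthur, *A trace formula for reductive groups I: terms associated to classes in `G(ℚ)`*, Duke
  Math. J. 45 (1978), §5 [Arthur1978TraceFormulaI].
-/

set_option autoImplicit false

noncomputable section

open NumberField IsDedekindDomain Topology Set
open scoped NNReal MatrixGroups Pointwise

namespace Literature.NumberTheory.Automorphic

namespace UnitaryGroup

variable {F E : Type} [Field F] [NumberField F] [Field E] [NumberField E] [Algebra F E]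
  {c : E ≃ₐ[F] E} {N : ℕ}

/-! ## §1 Root values: continuity and multiplicativity on torus elements -/

/-- `b ↦ diagUnit b i` is continuous on `B(𝔸_F)` (entries of `b` and of `b⁻¹` are continuous).
[cite: Rogawski1990, §1.10] -/
theorem continuous_diagUnit : Continuous fun b : borelAdelic F E c N => diagUnit b.2 := by
  have hmat : Continuous fun g : (quasiSplit F E c N).Adelic =>
      (adelicVal F E c N _ g : Matrix (Fin N) (Fin N) (AdeleRing (𝓞 E) E)) :=
    Units.continuous_val.comp continuous_subtype_val
  refine continuous_pi fun i => Units.continuous_iff.2 ⟨?_, ?_⟩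
  · exact (hmat.comp continuous_subtype_val).matrix_elem i i
  · change Continuous fun b : borelAdelic F E c N =>
      (adelicVal F E c N _ ((b : (quasiSplit F E c N).Adelic)⁻¹) : Matrix (Fin N) (Fin N) (AdeleRing (𝓞 E) E)) i i
    exact (hmat.comp continuous_subtype_val.inv).matrix_elem i i

/-- The root value `b ↦ d₀⁻¹ d₁` (`d = diagUnit b`) is continuous on `B(𝔸_F)` (`N = 3`).
[cite: Rogawski1990, §1.10] -/
theorem continuous_rootValue₁ : Continuous fun b : borelAdelic F E c 3 =>
    (((diagUnit b.2 0)⁻¹ * diagUnit b.2 1 : (AdeleRing (𝓞 E) E)ˣ) : AdeleRing (𝓞 E) E) :=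
  Units.continuous_val.comp
    (((continuous_apply 0).comp continuous_diagUnit).inv.mul ((continuous_apply 1).comp continuous_diagUnit))

/-- The root value `b ↦ d₀⁻¹ d₂` (`d = diagUnit b`) is continuous on `B(𝔸_F)` (`N = 3`).
[cite: Rogawski1990, §1.10] -/
theorem continuous_rootValue₂ : Continuous fun b : borelAdelic F E c 3 =>
    (((diagUnit b.2 0)⁻¹ * diagUnit b.2 2 : (AdeleRing (𝓞 E) E)ˣ) : AdeleRing (𝓞 E) E) :=
  Units.continuous_val.comp
    (((continuous_apply 0).comp continuous_diagUnit).inv.mul ((continuous_apply 2).comp continuous_diagUnit))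

/-- For a TORUS element `t` (`torusPart t = t`) the matrix of `t` is `diag(diagUnit t)`.
[cite: Rogawski1990, §1.10] -/
theorem adelicVal_eq_glDiagonal_of_torusPart_eq {t : borelAdelic F E c N} (ht : torusPart t = t) :
    adelicVal F E c N _ (t : (quasiSplit F E c N).Adelic) = glDiagonal N (AdeleRing (𝓞 E) E) (diagUnit t.2) := by
  conv_lhs => rw [← ht]
  exact adelicVal_torusPart t

/-- The diagonal entries of `torusPart b` are those of `b`. [cite: Rogawski1990, §1.10] -/
theorem diagUnit_torusPart (b : borelAdelic F E c N) (i : Fin N) :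
    diagUnit (torusPart b).2 i = diagUnit b.2 i := by
  refine Units.ext ?_
  rw [coe_diagUnit, adelicVal_torusPart, coe_glDiagonal, Matrix.diagonal_apply_eq, coe_diagUnit]

/-- **Diagonal entries of a product of torus elements multiply**: `diagUnit (t t') i = diagUnit t i · diagUnit t' i`
for `torusPart t = t`, `torusPart t' = t'`. [cite: Rogawski1990, §1.10] -/
theorem diagUnit_mul_of_torusPart_eq {t t' : borelAdelic F E c N} (ht : torusPart t = t)
    (ht' : torusPart t' = t') (i : Fin N) :
    diagUnit (t * t').2 i = diagUnit t.2 i * diagUnit t'.2 i := by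
  refine Units.ext ?_
  rw [coe_diagUnit, Units.val_mul, coe_diagUnit, coe_diagUnit]
  change (adelicVal F E c N _ ((t : (quasiSplit F E c N).Adelic) * (t' : (quasiSplit F E c N).Adelic)) :
      Matrix (Fin N) (Fin N) (AdeleRing (𝓞 E) E)) i i = _
  rw [map_mul, Units.val_mul, adelicVal_eq_glDiagonal_of_torusPart_eq ht,
    adelicVal_eq_glDiagonal_of_torusPart_eq ht', coe_glDiagonal, coe_glDiagonal, Matrix.diagonal_mul_diagonal,
    Matrix.diagonal_apply_eq, Matrix.diagonal_apply_eq, Matrix.diagonal_apply_eq]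

/-- Root value `d₀⁻¹ d₁` of a product of torus elements. [cite: Rogawski1990, §1.10] -/
theorem rootValue₁_mul {t t' : borelAdelic F E c 3} (ht : torusPart t = t) (ht' : torusPart t' = t') :
    (((diagUnit (t * t').2 0)⁻¹ * diagUnit (t * t').2 1 : (AdeleRing (𝓞 E) E)ˣ) : AdeleRing (𝓞 E) E) =
      (((diagUnit t.2 0)⁻¹ * diagUnit t.2 1 : (AdeleRing (𝓞 E) E)ˣ) : AdeleRing (𝓞 E) E) *
        (((diagUnit t'.2 0)⁻¹ * diagUnit t'.2 1 : (AdeleRing (𝓞 E) E)ˣ) : AdeleRing (𝓞 E) E) := by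
  rw [← Units.val_mul, diagUnit_mul_of_torusPart_eq ht ht' 0, diagUnit_mul_of_torusPart_eq ht ht' 1]
  congr 1
  rw [mul_inv]
  simp only [mul_assoc, mul_left_comm]

/-- Root value `d₀⁻¹ d₂` of a product of torus elements. [cite: Rogawski1990, §1.10] -/
theorem rootValue₂_mul {t t' : borelAdelic F E c 3} (ht : torusPart t = t) (ht' : torusPart t' = t') :
    (((diagUnit (t * t').2 0)⁻¹ * diagUnit (t * t').2 2 : (AdeleRing (𝓞 E) E)ˣ) : AdeleRing (𝓞 E) E) =
      (((diagUnit t.2 0)⁻¹ * diagUnit t.2 2 : (AdeleRing (𝓞 E) E)ˣ) : AdeleRing (𝓞 E) E) *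
        (((diagUnit t'.2 0)⁻¹ * diagUnit t'.2 2 : (AdeleRing (𝓞 E) E)ˣ) : AdeleRing (𝓞 E) E) := by
  rw [← Units.val_mul, diagUnit_mul_of_torusPart_eq ht ht' 0, diagUnit_mul_of_torusPart_eq ht ht' 2]
  congr 1
  rw [mul_inv]
  simp only [mul_assoc, mul_left_comm]

/-! ## §2 Torus part and height of `b = n t k` -/

/-- **`torusPart (n t k) = t · torusPart k`** for `n ∈ N(𝔸_F)`, `torusPart t = t` (★ `torusPart_mul`,
★ `torusPart_eq_one_of_mem`). [cite: Rogawski1990, §1.10] -/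
theorem torusPart_mul_mul_eq {n t k : borelAdelic F E c N}
    (hn : (n : (quasiSplit F E c N).Adelic) ∈ adelicUnipotent F E c N) (ht : torusPart t = t) :
    torusPart (n * t * k) = t * torusPart k := by
  rw [torusPart_mul, torusPart_mul, torusPart_eq_one_of_mem hn, one_mul, ht]

/-- **`H(n t k) = H(t)`** for `n ∈ N(𝔸_F)` and `k ∈ B ∩ K_U` (★ `borelHeight_unipotent_mul`,
★ `borelHeight_mul_of_mem_comap_standardMaximalCompactGL`). [cite: Rogawski1990, §2.2 (p. 13)] -/
theorem borelHeight_mul_mul_eq {N : ℕ} [NeZero N] {n t k : borelAdelic F E c N}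
    (hn : (n : (quasiSplit F E c N).Adelic) ∈ adelicUnipotent F E c N)
    (hk : adelicVal F E c N ((StdForm.antidiagonal N).over E) (k : (quasiSplit F E c N).Adelic) ∈
      standardMaximalCompactGL N E) :
    borelHeight (((n * t * k : borelAdelic F E c N)) : (quasiSplit F E c N).Adelic) =
      borelHeight ((t : borelAdelic F E c N) : (quasiSplit F E c N).Adelic) := by
  rw [Subgroup.coe_mul, Subgroup.coe_mul, mul_assoc, borelHeight_unipotent_mul hn,
    borelHeight_mul_of_mem_comap_standardMaximalCompactGL (Subgroup.mem_comap.2 hk)]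

/-! ## §3 The structure clause on `S = Ω · S_T · (B ∩ K_U)` -/

/-- `N(𝔸_F)` is closed in `G(𝔸_F)` (plumbing, as in `UnitaryGroupKernelBorelTorusFibration`). [folklore] -/
private theorem isClosed_adelicUnipotent₁₀ :
    IsClosed ((adelicUnipotent F E c N : Set (quasiSplit F E c N).Adelic)) := by
  haveI : T2Space (FiniteAdeleRing (𝓞 E) E) := inferInstanceAs <| T2Space
    (RestrictedProduct (fun w : HeightOneSpectrum (𝓞 E) => w.adicCompletion E)
      (fun w => (w.adicCompletionIntegers E : Set (w.adicCompletion E))) Filter.cofinite)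
  haveI : T2Space (InfiniteAdeleRing E) :=
    inferInstanceAs <| T2Space ((w : InfinitePlace E) → w.Completion)
  haveI : T2Space (AdeleRing (𝓞 E) E) := inferInstanceAs <| T2Space (InfiniteAdeleRing E × FiniteAdeleRing (𝓞 E) E)
  change IsClosed (⇑(adelicVal F E c N ((StdForm.antidiagonal N).over E)) ⁻¹'
    ((upperUnitriangular (Fin N) (AdeleRing (𝓞 E) E) : Subgroup (GL (Fin N) (AdeleRing (𝓞 E) E))) :
      Set (GL (Fin N) (AdeleRing (𝓞 E) E))))
  exact (isClosed_upperUnitriangular (R := AdeleRing (𝓞 E) E)).preimage continuous_subtype_val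

/-- **THE STRUCTURE CLAUSE OF THE BOREL SIEGEL SET.** Let `Ω ⊆ B(𝔸_F)` be compact and contained in
`N(𝔸_F)`, `S_T ⊆ B(𝔸_F)` consist of torus elements whose root values `d₀⁻¹ d₁`, `d₀⁻¹ d₂` lie in compact
`R₁, R₂ ⊆ 𝔸_E` above height `1`, and `B ∩ K_U = {k : adelicVal k ∈ K_∞ · GL₃(𝒪̂_E)}`. Then there are compact
`Ω' ⊆ G(𝔸_F)` and `R₁', R₂' ⊆ 𝔸_E` such that every `b ∈ Ω · S_T · (B ∩ K_U)` with `1 ≤ H(b)` has unipotent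
part `(torusPart b)⁻¹ b ∈ Ω'` and root values in `R₁', R₂'` (the membership hypotheses of ★
`exists_forall_card_mul_measure_le_mul_torusRootModulus` ∕ ★ `exists_forall_enorm_kernel_sub_kernelBorel_le_of_oscillation`).
With `b = n t k`, `k = t_k n_k`: `torusPart b = t t_k`, the root values multiply (§1) and those of `t_k`
range over the continuous image of the compact `B ∩ K_U`, `H(b) = H(t)` (§2), and
`(torusPart b)⁻¹ b = (t t_k)⁻¹ n (t t_k) · n_k` with the first factor in the compact of ★
`exists_isCompact_torusConj_mem`. [cite: Rogawski1990, §2.2 (p. 13)] -/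
theorem exists_isCompact_structure_of_mem_siegel (hc : c * c = 1)
    {Ω ST : Set (borelAdelic F E c 3)} (hΩc : IsCompact Ω)
    (hΩN : Ω ⊆ (unipotentInBorel F E c 3 : Set (borelAdelic F E c 3)))
    (hSTt : ∀ t ∈ ST, torusPart t = t)
    {R₁ R₂ : Set (AdeleRing (𝓞 E) E)} (hR₁ : IsCompact R₁) (hR₂ : IsCompact R₂)
    (hST₁ : ∀ t ∈ ST, 1 ≤ borelHeight ((t : borelAdelic F E c 3) : (quasiSplit F E c 3).Adelic) →
      (((diagUnit t.2 0)⁻¹ * diagUnit t.2 1 : (AdeleRing (𝓞 E) E)ˣ) : AdeleRing (𝓞 E) E) ∈ R₁)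
    (hST₂ : ∀ t ∈ ST, 1 ≤ borelHeight ((t : borelAdelic F E c 3) : (quasiSplit F E c 3).Adelic) →
      (((diagUnit t.2 0)⁻¹ * diagUnit t.2 2 : (AdeleRing (𝓞 E) E)ˣ) : AdeleRing (𝓞 E) E) ∈ R₂) :
    ∃ Ω' : Set (quasiSplit F E c 3).Adelic, IsCompact Ω' ∧
      ∃ R₁' R₂' : Set (AdeleRing (𝓞 E) E), IsCompact R₁' ∧ IsCompact R₂' ∧
        ∀ b ∈ Ω * ST * {k : borelAdelic F E c 3 |
            adelicVal F E c 3 ((StdForm.antidiagonal 3).over E) (k : (quasiSplit F E c 3).Adelic) ∈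
              standardMaximalCompactGL 3 E},
          1 ≤ borelHeight ((b : borelAdelic F E c 3) : (quasiSplit F E c 3).Adelic) →
          (((torusPart b)⁻¹ * b : borelAdelic F E c 3) : (quasiSplit F E c 3).Adelic) ∈ Ω' ∧
          (((diagUnit b.2 0)⁻¹ * diagUnit b.2 1 : (AdeleRing (𝓞 E) E)ˣ) : AdeleRing (𝓞 E) E) ∈ R₁' ∧
          (((diagUnit b.2 0)⁻¹ * diagUnit b.2 2 : (AdeleRing (𝓞 E) E)ˣ) : AdeleRing (𝓞 E) E) ∈ R₂' := by
  -- `B ∩ K_U` is compact in `B(𝔸_F)`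
  set KB : Set (borelAdelic F E c 3) := {k : borelAdelic F E c 3 |
    adelicVal F E c 3 ((StdForm.antidiagonal 3).over E) (k : (quasiSplit F E c 3).Adelic) ∈
      standardMaximalCompactGL 3 E} with hKB
  have hKBc : IsCompact KB := by
    have h := isClosed_borelAdelic.isClosedEmbedding_subtypeVal.isCompact_preimage
      (isCompact_comap_adelicVal_standardMaximalCompactGL (F := F) (E := E) (c := c) (N := 3))
    exact h
  -- the root values of `torusPart k`, `k ∈ B ∩ K_U`, range in compacta `U₁, U₂`
  have hKT : IsCompact (torusPart '' KB) := hKBc.image continuous_torusPart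
  set U₁ : Set (AdeleRing (𝓞 E) E) := (fun s : borelAdelic F E c 3 =>
    (((diagUnit s.2 0)⁻¹ * diagUnit s.2 1 : (AdeleRing (𝓞 E) E)ˣ) : AdeleRing (𝓞 E) E)) '' (torusPart '' KB) with hU₁
  set U₂ : Set (AdeleRing (𝓞 E) E) := (fun s : borelAdelic F E c 3 =>
    (((diagUnit s.2 0)⁻¹ * diagUnit s.2 2 : (AdeleRing (𝓞 E) E)ˣ) : AdeleRing (𝓞 E) E)) '' (torusPart '' KB) with hU₂
  have hU₁c : IsCompact U₁ := hKT.image continuous_rootValue₁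
  have hU₂c : IsCompact U₂ := hKT.image continuous_rootValue₂
  -- the enlarged root windows `R₁' = R₁ · U₁`, `R₂' = R₂ · U₂`
  set R₁' : Set (AdeleRing (𝓞 E) E) :=
    (fun p : AdeleRing (𝓞 E) E × AdeleRing (𝓞 E) E => p.1 * p.2) '' (R₁ ×ˢ U₁) with hR₁'
  set R₂' : Set (AdeleRing (𝓞 E) E) :=
    (fun p : AdeleRing (𝓞 E) E × AdeleRing (𝓞 E) E => p.1 * p.2) '' (R₂ ×ˢ U₂) with hR₂'
  have hR₁'c : IsCompact R₁' := (hR₁.prod hU₁c).image (continuous_fst.mul continuous_snd)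
  have hR₂'c : IsCompact R₂' := (hR₂.prod hU₂c).image (continuous_fst.mul continuous_snd)
  -- `Ω` as a compact subset `W` of `N(𝔸_F) = adelicUnipotent`
  set W : Set (adelicUnipotent F E c 3) := (fun m : adelicUnipotent F E c 3 => (m : (quasiSplit F E c 3).Adelic)) ⁻¹'
    ((Subtype.val : borelAdelic F E c 3 → (quasiSplit F E c 3).Adelic) '' Ω) with hW
  have hWc : IsCompact W :=
    (isClosed_adelicUnipotent₁₀ (F := F) (E := E) (c := c) (N := 3)).isClosedEmbedding_subtypeVal.isCompact_preimage
      (hΩc.image continuous_subtype_val)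
  -- torus contraction (★ H4-d §2) with the enlarged windows
  obtain ⟨W', hW'c, hW'⟩ := exists_isCompact_torusConj_mem hc hWc hR₁'c hR₂'c
  -- the unipotent parts `(torusPart k)⁻¹ k`, `k ∈ B ∩ K_U`, range in a compact `NK ⊆ G(𝔸_F)`
  set NK : Set (quasiSplit F E c 3).Adelic := (fun k : borelAdelic F E c 3 =>
    (((torusPart k)⁻¹ * k : borelAdelic F E c 3) : (quasiSplit F E c 3).Adelic)) '' KB with hNK
  have hNKc : IsCompact NK :=
    hKBc.image ((continuous_torusPart.inv.mul continuous_id).subtype_val)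
  -- `Ω' = W' · NK`
  set Ω' : Set (quasiSplit F E c 3).Adelic :=
    (fun p : (quasiSplit F E c 3).Adelic × (quasiSplit F E c 3).Adelic => p.1 * p.2) ''
      (((fun m : adelicUnipotent F E c 3 => (m : (quasiSplit F E c 3).Adelic)) '' W') ×ˢ NK) with hΩ'
  have hΩ'c : IsCompact Ω' := ((hW'c.image continuous_subtype_val).prod hNKc).image
    (continuous_fst.mul continuous_snd)
  refine ⟨Ω', hΩ'c, R₁', R₂', hR₁'c, hR₂'c, ?_⟩
  -- unpack `b = n t k`
  rintro b ⟨x, ⟨n, hn, t, ht, rfl⟩, k, hk, rfl⟩ hH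
  have hnN : ((n : borelAdelic F E c 3) : (quasiSplit F E c 3).Adelic) ∈ adelicUnipotent F E c 3 := hΩN hn
  have htt : torusPart t = t := hSTt t ht
  have hkK : adelicVal F E c 3 ((StdForm.antidiagonal 3).over E) (k : (quasiSplit F E c 3).Adelic) ∈
      standardMaximalCompactGL 3 E := hk
  -- `H(b) = H(t) ≥ 1`
  have hHt : 1 ≤ borelHeight ((t : borelAdelic F E c 3) : (quasiSplit F E c 3).Adelic) := by
    rw [← borelHeight_mul_mul_eq hnN hkK]
    exact hH
  -- torus part `t t_k`
  set tk : borelAdelic F E c 3 := torusPart k with htk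
  have htkt : torusPart tk = tk :=
    torusPart_eq_self_of_mem (torusPart_mem_torusAdelic k)
  have hTP : torusPart (n * t * k) = t * tk := torusPart_mul_mul_eq hnN htt
  have hTPt : torusPart (t * tk) = t * tk := by rw [torusPart_mul, htt, htkt]
  -- `t · tk ∈ T(𝔸_F)` with diagonal `d = diagUnit (t tk)`
  have hTmem : (((t * tk : borelAdelic F E c 3)) : (quasiSplit F E c 3).Adelic) ∈ torusAdelic F E c 3 := by
    have h := torusPart_mem_torusAdelic (t * tk)
    rwa [hTPt] at h
  have hd : glDiagonal 3 (AdeleRing (𝓞 E) E) (diagUnit (t * tk).2) =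
      adelicVal F E c 3 _ (((t * tk : borelAdelic F E c 3)) : (quasiSplit F E c 3).Adelic) :=
    (adelicVal_eq_glDiagonal_of_torusPart_eq hTPt).symm
  -- the root values of `b` are those of `t · tk`, which lie in `R₁', R₂'`
  have hroot : ∀ i, diagUnit (n * t * k).2 i = diagUnit (t * tk).2 i := fun i => by
    rw [← diagUnit_torusPart (n * t * k) i]
    exact congrArg (fun s : borelAdelic F E c 3 => diagUnit s.2 i) hTP
  have htkU : tk ∈ torusPart '' KB := ⟨k, hk, htk.symm⟩
  have hR₁mem : (((diagUnit (t * tk).2 0)⁻¹ * diagUnit (t * tk).2 1 : (AdeleRing (𝓞 E) E)ˣ) : AdeleRing (𝓞 E) E) ∈ R₁' := by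
    rw [rootValue₁_mul htt htkt]
    exact ⟨(_, _), Set.mk_mem_prod (hST₁ t ht hHt) (Set.mem_image_of_mem _ htkU), rfl⟩
  have hR₂mem : (((diagUnit (t * tk).2 0)⁻¹ * diagUnit (t * tk).2 2 : (AdeleRing (𝓞 E) E)ˣ) : AdeleRing (𝓞 E) E) ∈ R₂' := by
    rw [rootValue₂_mul htt htkt]
    exact ⟨(_, _), Set.mk_mem_prod (hST₂ t ht hHt) (Set.mem_image_of_mem _ htkU), rfl⟩
  refine ⟨?_, ?_, ?_⟩
  · -- unipotent part `(t tk)⁻¹ (n t k) = Ad((t tk)⁻¹)(n) · (tk⁻¹ k) ∈ W' · NK`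
    set n' : adelicUnipotent F E c 3 := ⟨((n : borelAdelic F E c 3) : (quasiSplit F E c 3).Adelic), hnN⟩ with hn'
    have hn'W : n' ∈ W := ⟨n, hn, rfl⟩
    have hconj := hW' _ hTmem (diagUnit (t * tk).2) hd hR₁mem hR₂mem n' hn'W
    rw [hTP]
    refine ⟨(_, _), Set.mk_mem_prod (Set.mem_image_of_mem _ hconj) ⟨k, hk, rfl⟩, ?_⟩
    change ((((t * tk : borelAdelic F E c 3)) : (quasiSplit F E c 3).Adelic))⁻¹ *
        ((n : borelAdelic F E c 3) : (quasiSplit F E c 3).Adelic) *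
        (((t * tk : borelAdelic F E c 3)) : (quasiSplit F E c 3).Adelic) *
        ((((torusPart k)⁻¹ * k : borelAdelic F E c 3)) : (quasiSplit F E c 3).Adelic) =
      ((((t * tk)⁻¹ * (n * t * k) : borelAdelic F E c 3)) : (quasiSplit F E c 3).Adelic)
    rw [← htk]
    simp only [Subgroup.coe_mul, Subgroup.coe_inv]
    group
  · rw [hroot 0, hroot 1]
    exact hR₁mem
  · rw [hroot 0, hroot 2]
    exact hR₂mem

end UnitaryGroup

end Literature.NumberTheory.Automorphic
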